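import Summits.ValiantsHypothesis.ValiantsHypothesis.Theorems.LacunarySymmetroidMatrixDescartesCensusFatSectors
import Summits.ValiantsHypothesis.ValiantsHypothesis.Theorems.LacunarySymmetroidMatrixDescartesCensusRatioCloses

/-!
# `MatrixDescartes` — the summit-relevant window of the route: a `t/(t+1)` saving on sizes `m ≳ K^(2 − 1/(t+1))`

CONDITIONAL: proves no part of MatrixDescartes; the window hypothesis MDR(t+1,t)|window is OPEN and implies VH by this
theorem, hence ≥ summit-hard; ROUTE-DESIGN DATUM: the route needs a `t/(t+1)` saving only on sizes `m ≳ K^(2−1/(t+1))`.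

HONEST FRAMING.  Object-search cell `pub-symmetroid`, crux `Theses.LacunarySymmetroid.MatrixDescartes`
(ledger item `stmt-ValiantsHypothesis-18050`, route `LacunarySymmetroid`; seat `val-sym-mdr-p1`).  This file proves NO
part of the crux and nothing about `VP ≠ VNP` unconditionally.  It combines two kernel facts of the companion files —
the Descartes sector (`…CensusFatSectors`: below a power of `K` the crux's inequality is free) and the exchange rate of
the route (`…CensusRatioCloses`: any constant-factor saving `log₂ Z ≤ (b/a)·K log₂ K`, `b < a`, already yields the
summit through the PROVED transfer and witness) — into one statement of WHERE the route `LacunarySymmetroid` actually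
needs mathematics:

* `matrixDescartesRatio_subpowerSector` (§1): for `b ≤ a` and EVERY `K ≥ 1`, every format with
  `(12(m+K))^a ≤ K^(a+b)` — sizes `m ≤ K^(1+b/a)/12 − K` — satisfies `Z^a ≤ 2^(b·K⌊log₂K⌋)` for every `K`-term real
  symmetric `m × m` pencil, by Descartes alone.  (`b = 1` is `Census.matrixDescartes_subpowerSector`.)
* `valiant_of_ratioWindow` (§2): consequently, for every `t ≥ 1`, the summit `ValiantsHypothesis` follows from the
  ratio hypothesis `Z^(t+1) ≤ 2^(t·K⌊log₂K⌋)` asserted ONLY on the window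
  `K^(2t+1) < (12(m+K))^(t+1)` (i.e. `m > K^(2 − 1/(t+1))/12 − K`), `m ≤ 2^((⌊log₂K⌋+c)^c)`, eventually in `K`, for
  every `c`.  As `t` grows the hypothesis weakens (saving factor `t/(t+1) → 1`) AND its window shrinks towards the
  square tower `m ≈ K²`; no single `t` is claimed optimal and the limit is not a statement.
* `valiant_of_ratioWindow_io` (appended): the same with the window bound assumed only for INFINITELY MANY `K` (per `c`).

Reading (bookkeeping, not a claim): the summit-bearing content of the route is «beat the witness rate `K log₂ K` by a
constant factor on symmetric lacunary pencils of sizes between `K^(2−δ)` and `2^(polylog K)`»; there Descartes' rule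
gives `log₂ Z ≲ K log₂(m/K)`, which is `≥ (1−δ)K log₂ K`, so the hypothesis is NOT free anywhere in its window, and it
implies `VH`, so it is at least summit-hard.  Nothing here bears on `DoorA26` / `DoorA34` or any census numeral.

[folklore] Elementary arithmetic on top of the two companion files.
-/

-- `Summit.ValiantsHypothesis.ValiantsHypothesis.…` repeats a component by the D-0017 layout
-- (single-conjunct summit), which the `dupNamespace` linter flags; the name is mandated.
set_option linter.dupNamespace false

namespace Summit.ValiantsHypothesis.ValiantsHypothesis.Theorems.LacunarySymmetroidMatrixDescartes.Census

open scoped BigOperators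
open Polynomial

/-! ## §1 The Descartes sector of the ratio forms -/

/-- The arithmetic of the ratio sector: if `Z ≤ 2C`, `K^K · C ≤ (3N)^K` and `(12N)^a ≤ K^(a+b)` with `b ≤ a`,
`K ≥ 1`, then `Z^a ≤ 2^(b·K⌊log₂K⌋)`: `Z^a (K^K)^a 2^(bK) ≤ 2^a 2^(bK) (3N)^(Ka) ≤ (12N)^(aK) ≤ (K^K)^a K^(bK)`, cancel
`(K^K)^a`, and `K^(bK) ≤ 2^(bK(⌊log₂K⌋+1))`. [folklore] -/
theorem descartesSector_arith_ratio (a b K N C Z : ℕ) (hba : b ≤ a) (hK : 0 < K) (hZ : Z ≤ 2 * C)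
    (hC : K ^ K * C ≤ (3 * N) ^ K) (hN : (12 * N) ^ a ≤ K ^ (a + b)) :
    Z ^ a ≤ 2 ^ (b * (K * Nat.log 2 K)) := by
  have hK2 : K ≤ 2 ^ (Nat.log 2 K + 1) := (Nat.lt_pow_succ_log_self one_lt_two K).le
  have hKK : K ^ (b * K) ≤ 2 ^ (b * (K * Nat.log 2 K)) * 2 ^ (b * K) :=
    calc K ^ (b * K) ≤ (2 ^ (Nat.log 2 K + 1)) ^ (b * K) := Nat.pow_le_pow_left hK2 _
      _ = 2 ^ (b * (K * Nat.log 2 K) + b * K) := by rw [← pow_mul]; congr 1; ring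
      _ = 2 ^ (b * (K * Nat.log 2 K)) * 2 ^ (b * K) := pow_add 2 _ _
  have h1 : Z ^ a ≤ (2 * C) ^ a := Nat.pow_le_pow_left hZ a
  have h3 : Z ^ a * (K ^ K) ^ a ≤ 2 ^ a * (3 * N) ^ (K * a) :=
    calc Z ^ a * (K ^ K) ^ a ≤ (2 * C) ^ a * (K ^ K) ^ a := Nat.mul_le_mul_right _ h1
      _ = 2 ^ a * (K ^ K * C) ^ a := by rw [mul_pow, mul_pow]; ring
      _ ≤ 2 ^ a * ((3 * N) ^ K) ^ a := Nat.mul_le_mul_left _ (Nat.pow_le_pow_left hC a)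
      _ = 2 ^ a * (3 * N) ^ (K * a) := by rw [← pow_mul]
  have h4 : 2 ^ a * 2 ^ (b * K) ≤ 4 ^ (K * a) := by
    have hqK : a + b * K ≤ 2 * (K * a) := by nlinarith
    calc 2 ^ a * 2 ^ (b * K) = 2 ^ (a + b * K) := (pow_add 2 a (b * K)).symm
      _ ≤ 2 ^ (2 * (K * a)) := Nat.pow_le_pow_right (by norm_num) hqK
      _ = 4 ^ (K * a) := by rw [pow_mul]; norm_num
  have h5 : ((12 * N) ^ a) ^ K ≤ (K ^ (a + b)) ^ K := Nat.pow_le_pow_left hN K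
  have h6 : (K ^ (a + b)) ^ K = (K ^ K) ^ a * K ^ (b * K) := by
    rw [← pow_mul, ← pow_mul, ← pow_add]; congr 1; ring
  have h7 : ((12 * N) ^ a) ^ K = 4 ^ (K * a) * (3 * N) ^ (K * a) := by
    rw [← pow_mul, show (12 : ℕ) * N = 4 * (3 * N) by ring, mul_pow, mul_comm a K]
  have h8 : Z ^ a * (K ^ K) ^ a * 2 ^ (b * K) ≤ (K ^ K) ^ a * K ^ (b * K) :=
    calc Z ^ a * (K ^ K) ^ a * 2 ^ (b * K) ≤ 2 ^ a * (3 * N) ^ (K * a) * 2 ^ (b * K) :=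
          Nat.mul_le_mul_right _ h3
      _ = (2 ^ a * 2 ^ (b * K)) * (3 * N) ^ (K * a) := by ring
      _ ≤ 4 ^ (K * a) * (3 * N) ^ (K * a) := Nat.mul_le_mul_right _ h4
      _ = ((12 * N) ^ a) ^ K := h7.symm
      _ ≤ (K ^ (a + b)) ^ K := h5
      _ = (K ^ K) ^ a * K ^ (b * K) := h6
  have h9 : Z ^ a * 2 ^ (b * K) ≤ K ^ (b * K) := by
    have hPq : 0 < (K ^ K) ^ a := pow_pos (pow_pos hK K) a
    have h' : (K ^ K) ^ a * (Z ^ a * 2 ^ (b * K)) ≤ (K ^ K) ^ a * K ^ (b * K) :=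
      calc (K ^ K) ^ a * (Z ^ a * 2 ^ (b * K)) = Z ^ a * (K ^ K) ^ a * 2 ^ (b * K) := by ring
        _ ≤ (K ^ K) ^ a * K ^ (b * K) := h8
    exact Nat.le_of_mul_le_mul_left h' hPq
  exact Nat.le_of_mul_le_mul_right (h9.trans hKK) (pow_pos two_pos _)

/-- **The Descartes sector of the ratio forms.**  For `b ≤ a` and EVERY `K ≥ 1`: if `(12(m+K))^a ≤ K^(a+b)` —
sizes `m ≤ K^(1+b/a)/12 − K` — then every `K`-term real symmetric `m × m` lacunary pencil has `Z^a ≤ 2^(b·K⌊log₂K⌋)`,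
by Descartes' rule alone.  (`b = 1`: `Census.matrixDescartes_subpowerSector`; `b = a`: sizes up to `≈ K²`.) [folklore] -/
theorem matrixDescartesRatio_subpowerSector (a b K m : ℕ) (hba : b ≤ a) (hK : 0 < K)
    (hmK : (12 * (m + K)) ^ a ≤ K ^ (a + b))
    (d : Fin K → ℕ) (S : Fin K → Matrix (Fin m) (Fin m) ℝ) (hS : ∀ l, (S l).IsSymm) :
    (Matrix.det (∑ l, ((Polynomial.X : Polynomial ℝ) ^ d l) • (S l).map Polynomial.C)).roots.toFinset.card ^ a
      ≤ 2 ^ (b * (K * Nat.log 2 K)) :=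
  descartesSector_arith_ratio a b K (m + K) (Nat.choose (m + K) K) _ hba hK
    (card_roots_le_two_mul_choose m K hK d S hS) (pow_self_mul_choose_le m K) hmK

/-! ## §2 The summit-relevant window of the route -/

/-- **The route's summit-relevant window.**  For every `t` (of interest: `t ≥ 1`): if for every `c` there is `K₀` such that for all
`K ≥ K₀` and all sizes `m` in the WINDOW `K^(2t+1) < (12(m+K))^(t+1)` (i.e. `m > K^(2 − 1/(t+1))/12 − K`),
`m ≤ 2^((⌊log₂K⌋+c)^c)`, every `K`-term real symmetric `m × m` lacunary pencil has `Z^(t+1) ≤ 2^(t·K⌊log₂K⌋)` — a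
saving of the factor `t/(t+1)` against the witness rate — then `VP ≠ VNP` over `ℂ`.  Below the window the same
inequality is a theorem (§1), so the hypothesis extends to all sizes and `Census.valiant_of_matrixDescartesRatio`
applies.  The hypothesis is OPEN and at least summit-hard; nothing is asserted about it. [folklore] -/
theorem valiant_of_ratioWindow (t : ℕ)
    (h : ∀ c : ℕ, ∃ K₀ : ℕ, ∀ K m : ℕ, K₀ ≤ K → K ^ (2 * t + 1) < (12 * (m + K)) ^ (t + 1) →
      m ≤ 2 ^ ((Nat.log 2 K + c) ^ c) →
      ∀ (d : Fin K → ℕ) (S : Fin K → Matrix (Fin m) (Fin m) ℝ), (∀ l, (S l).IsSymm) →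
        (Matrix.det (∑ l, ((Polynomial.X : Polynomial ℝ) ^ d l) • (S l).map Polynomial.C)).roots.toFinset.card
            ^ (t + 1) ≤ 2 ^ (t * (K * Nat.log 2 K))) :
    _root_.ValiantsHypothesis := by
  refine valiant_of_matrixDescartesRatio (t + 1) t (Nat.lt_succ_self t) fun c => ?_
  obtain ⟨K₀, hK₀⟩ := h c
  refine ⟨max 1 K₀, fun K m hK hm d S hS => ?_⟩
  have hK1 : 0 < K := lt_of_lt_of_le one_pos (le_of_max_le_left hK)
  rcases le_or_gt ((12 * (m + K)) ^ (t + 1)) (K ^ (2 * t + 1)) with hle | hlt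
  · have e : 2 * t + 1 = (t + 1) + t := by ring
    rw [e] at hle
    exact matrixDescartesRatio_subpowerSector (t + 1) t K m (Nat.le_succ t) hK1 hle d S hS
  · exact hK₀ K m (le_of_max_le_right hK) hlt hm d S hS

/-- **The window, infinitely often (appended 2026-08-26, same seat).**  For every `t`: if for every `c` and every
`K₁` there is SOME `K ≥ K₁` such that every `K`-term real symmetric `m × m` lacunary pencil with `m` in the window
`K^(2t+1) < (12(m+K))^(t+1)`, `m ≤ 2^((⌊log₂K⌋+c)^c)` has `Z^(t+1) ≤ 2^(t·K⌊log₂K⌋)`, then `VP ≠ VNP` over `ℂ`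
(`Census.valiant_of_matrixDescartesRatio_io` + the Descartes sector of §1 at that `K`).  CONDITIONAL: the hypothesis is
OPEN and implies `VH`; nothing is asserted about it. [folklore] -/
theorem valiant_of_ratioWindow_io (t : ℕ)
    (h : ∀ c K₁ : ℕ, ∃ K : ℕ, K₁ ≤ K ∧ ∀ m : ℕ, K ^ (2 * t + 1) < (12 * (m + K)) ^ (t + 1) →
      m ≤ 2 ^ ((Nat.log 2 K + c) ^ c) →
      ∀ (d : Fin K → ℕ) (S : Fin K → Matrix (Fin m) (Fin m) ℝ), (∀ l, (S l).IsSymm) →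
        (Matrix.det (∑ l, ((Polynomial.X : Polynomial ℝ) ^ d l) • (S l).map Polynomial.C)).roots.toFinset.card
            ^ (t + 1) ≤ 2 ^ (t * (K * Nat.log 2 K))) :
    _root_.ValiantsHypothesis := by
  refine valiant_of_matrixDescartesRatio_io (t + 1) t (Nat.lt_succ_self t) fun c K₁ => ?_
  obtain ⟨K, hK₁, hK⟩ := h c (max 1 K₁)
  refine ⟨K, le_trans (le_max_right _ _) hK₁, fun m hm d S hS => ?_⟩
  have hK1 : 0 < K := lt_of_lt_of_le one_pos (le_trans (le_max_left _ _) hK₁)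
  rcases le_or_gt ((12 * (m + K)) ^ (t + 1)) (K ^ (2 * t + 1)) with hle | hlt
  · have e : 2 * t + 1 = (t + 1) + t := by ring
    rw [e] at hle
    exact matrixDescartesRatio_subpowerSector (t + 1) t K m (Nat.le_succ t) hK1 hle d S hS
  · exact hK m hlt hm d S hS

end Summit.ValiantsHypothesis.ValiantsHypothesis.Theorems.LacunarySymmetroidMatrixDescartes.Census
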